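import Literature.MathematicalPhysics.QuantumManyBody.GroundState
import Literature.MathematicalPhysics.QuantumManyBody.BosonicFloorSymmetrisation
import Literature.MathematicalPhysics.QuantumManyBody.LiebYngvasonCellMethod
import Summits.AtomisticToContinuum.BoseEinsteinCondensation.Theorems.BECCutLineWeakDisorderGroundStateRigidityStubRigidityOfUnique
import Mathlib.MeasureTheory.Function.LpSeminorm.TriangleInequality
import HarnessLib

/-!
# Crux `GroundStateRigidity` (stmt-AtomisticToContinuum-9072), line `Sketch`:
# the registered stub `stub_existsNonnegGroundState`

Supports (does not close) stmt-AtomisticToContinuum-9072. **A nonnegative ground state exists**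
(Reed–Simon IV §XIII.12: `|Ψ₀|` is a ground state whenever `Ψ₀` is; diamagnetic / convexity
inequality for gradients, Lieb–Loss Thm 7.8): IF bounded-energy sequences of trial states are
`L²`-precompact with measurable, Dirichlet, Bose-symmetric limits (the registered statement of the
neighbouring stub `stub_compactness`, the ANTECEDENT, not re-proved), THEN for EVERY pair potential
`v` (hard cores included) and every `(N, L)` with `E₀ = groundStateEnergy v N L < ⊤` there is
`Ψ₀ ≥ 0` whose complexification `IsGroundState v L`.

Proof: a minimising sequence has, by compactness, a subsequence `Φₙ → Ψ` in `L²`; the candidate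
is `|Ψ|`. The regularised moduli `gₙ = √(εₙ² + |Φₙ|²) − εₙ`, `εₙ = 1/(n+1)` (the `sqrtReg` calculus
of `BosonicFloorSymmetrisation.lean` with a one-element family) are `C¹`, Dirichlet, symmetric,
with `|∇gₙ|² ≤ |∇Φₙ|²`, `gₙ² ≤ |Φₙ|²` and `|gₙ − |Ψ|| ≤ εₙ 1_{Λ^N} + |Φₙ − Ψ|` pointwise; so
`gₙ → |Ψ|` in `L²`, `‖gₙ‖₂ → 1`, and the trial states `Θₙ = gₙ/‖gₙ‖₂ → |Ψ|` have
`energy Θₙ ≤ ‖gₙ‖₂⁻² (E₀ + 1/(n+1)) → E₀`, whence `|Ψ|` is a ground state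
(`IsGroundState.of_tendstoL2`).
-/
noncomputable section

open MeasureTheory Filter
open scoped ENNReal NNReal Topology ComplexConjugate

namespace Summit.AtomisticToContinuum.BoseEinsteinCondensation.Theorems.GroundStateRigidity

open Literature.MathematicalPhysics.QuantumManyBody.BoseGas

namespace ExistsNonneg

variable {N : ℕ} {L : ℝ}

/-! ### Pointwise facts about the regularised modulus `√(ε² + |ψ|²) − ε` -/

/-- `‖(r : ℂ)‖₊² = ofReal (r²)` in `ℝ≥0∞`. [folklore] -/
theorem coe_nnnorm_ofReal_sq (r : ℝ) : (‖(r : ℂ)‖₊ : ℝ≥0∞) ^ 2 = ENNReal.ofReal (r ^ 2) := by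
  rw [Complex.nnnorm_real, coe_nnnorm_pow_two_eq_ofReal, Real.norm_eq_abs, sq_abs]

/-- `|√(ε² + s²) − ε − s| ≤ ε` for `ε, s ≥ 0`: the regularised modulus is uniformly `ε`-close to
the modulus (`s ≤ √(ε² + s²) ≤ ε + s`). [folklore] -/
theorem abs_sqrtReg_sub_le {ε s : ℝ} (hε : 0 ≤ ε) (hs : 0 ≤ s) :
    |Real.sqrt (ε ^ 2 + s ^ 2) - ε - s| ≤ ε := by
  have h1 : s ≤ Real.sqrt (ε ^ 2 + s ^ 2) := (Real.le_sqrt hs (by positivity)).2 (by nlinarith)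
  have h2 : Real.sqrt (ε ^ 2 + s ^ 2) ≤ ε + s :=
    (Real.sqrt_le_left (by positivity)).2 (by nlinarith)
  exact abs_le.2 ⟨by linarith, by linarith⟩

/-- **`L²`-distance of the regularised modulus to `|Ψ|`, pointwise**: for a trial state `Φ`,
`|g_ε(X) − |Ψ(X)||² ≤ 2ε² 1_{Λ^N}(X) + 2 |Φ(X) − Ψ(X)|²` (`|g_ε − |Φ|| ≤ ε` on the box, both vanish
off it, and `||Φ| − |Ψ|| ≤ |Φ − Ψ|`). [folklore] -/
theorem nnnorm_sqrtReg_sub_norm_sq_le (Φ : TrialState N L) (Ψ : Config N → ℂ) {ε : ℝ}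
    (hε : 0 < ε) (X : Config N) :
    (‖((Real.sqrt (ε ^ 2 + ∑ _j : Unit, ‖Φ.ψ X‖ ^ 2) - ε : ℝ) : ℂ) - ((‖Ψ X‖ : ℝ) : ℂ)‖₊ :
        ℝ≥0∞) ^ 2 ≤
      2 * (boxN N L).indicator (fun _ => ENNReal.ofReal (ε ^ 2)) X +
        2 * (‖Φ.ψ X - Ψ X‖₊ : ℝ≥0∞) ^ 2 := by
  rw [Fintype.sum_unique, ← Complex.ofReal_sub, coe_nnnorm_ofReal_sq]
  have key : ∀ b : ℝ, |Real.sqrt (ε ^ 2 + ‖Φ.ψ X‖ ^ 2) - ε - ‖Φ.ψ X‖| ≤ b →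
      ENNReal.ofReal ((Real.sqrt (ε ^ 2 + ‖Φ.ψ X‖ ^ 2) - ε - ‖Ψ X‖) ^ 2) ≤
        2 * ENNReal.ofReal (b ^ 2) + 2 * (‖Φ.ψ X - Ψ X‖₊ : ℝ≥0∞) ^ 2 := by
    intro b hb
    have h1 : (‖Φ.ψ X‖ - ‖Ψ X‖) ^ 2 ≤ ‖Φ.ψ X - Ψ X‖ ^ 2 := by
      rw [← sq_abs]
      exact pow_le_pow_left₀ (abs_nonneg _) (abs_norm_sub_norm_le _ _) 2
    have h2 : (Real.sqrt (ε ^ 2 + ‖Φ.ψ X‖ ^ 2) - ε - ‖Φ.ψ X‖) ^ 2 ≤ b ^ 2 := by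
      rw [← sq_abs]
      exact pow_le_pow_left₀ (abs_nonneg _) hb 2
    have h3 : (Real.sqrt (ε ^ 2 + ‖Φ.ψ X‖ ^ 2) - ε - ‖Ψ X‖) ^ 2 ≤
        2 * b ^ 2 + 2 * ‖Φ.ψ X - Ψ X‖ ^ 2 := by
      nlinarith [h1, h2, sq_nonneg ((Real.sqrt (ε ^ 2 + ‖Φ.ψ X‖ ^ 2) - ε - ‖Φ.ψ X‖) -
        (‖Φ.ψ X‖ - ‖Ψ X‖))]
    calc ENNReal.ofReal ((Real.sqrt (ε ^ 2 + ‖Φ.ψ X‖ ^ 2) - ε - ‖Ψ X‖) ^ 2)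
        ≤ ENNReal.ofReal (2 * b ^ 2 + 2 * ‖Φ.ψ X - Ψ X‖ ^ 2) := ENNReal.ofReal_le_ofReal h3
      _ = 2 * ENNReal.ofReal (b ^ 2) + 2 * (‖Φ.ψ X - Ψ X‖₊ : ℝ≥0∞) ^ 2 := by
          rw [ENNReal.ofReal_add (by positivity) (by positivity), ENNReal.ofReal_mul zero_le_two,
            ENNReal.ofReal_mul zero_le_two, ENNReal.ofReal_ofNat, coe_nnnorm_pow_two_eq_ofReal]
  by_cases hX : X ∈ boxN N L
  · rw [Set.indicator_of_mem hX]
    exact key ε (abs_sqrtReg_sub_le hε.le (norm_nonneg _))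
  · rw [Set.indicator_of_notMem hX]
    have h0 : Φ.ψ X = 0 := Φ.eq_zero X hX
    refine (key 0 ?_).trans (by simp)
    rw [h0, norm_zero, sub_zero, zero_pow two_ne_zero, add_zero, Real.sqrt_sq hε.le, sub_self,
      abs_zero]

/-- The complexified regularised modulus `(√(ε² + |ψ|²) − ε : ℂ)` of a `C¹` function is `C¹`
(`ε > 0`). [folklore] -/
theorem contDiff_sqrtRegC {ψ : Config N → ℂ} (hψ : ContDiff ℝ 1 ψ) {ε : ℝ} (hε : 0 < ε) :
    ContDiff ℝ 1 fun X : Config N =>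
      ((Real.sqrt (ε ^ 2 + ∑ _j : Unit, ‖ψ X‖ ^ 2) - ε : ℝ) : ℂ) :=
  Complex.ofRealCLM.contDiff.comp (contDiff_sqrtReg (fun _ : Unit => ψ) (fun _ => hψ) hε)

/-- **Diamagnetic inequality, pointwise**: the kinetic energy density of `(√(ε² + |ψ|²) − ε : ℂ)`
is at most that of `ψ` (convexity inequality for gradients in each coordinate direction).
[cite: LiebLoss2001, Thm. 7.8] -/
theorem kineticDensity_sqrtRegC_le {ψ : Config N → ℂ} (hψ : ContDiff ℝ 1 ψ) {ε : ℝ} (hε : 0 < ε)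
    (X : Config N) :
    kineticDensity (fun Y : Config N =>
        ((Real.sqrt (ε ^ 2 + ∑ _j : Unit, ‖ψ Y‖ ^ 2) - ε : ℝ) : ℂ)) X ≤ kineticDensity ψ X := by
  have hd : ∀ _j : Unit, DifferentiableAt ℝ ψ X := fun _ => (hψ.differentiable one_ne_zero) X
  refine Finset.sum_le_sum fun i _ => Finset.sum_le_sum fun k _ => ?_
  exact (nnnorm_fderiv_ofReal_sqrtReg_sq_le (fun _ : Unit => ψ) hd hε _).trans_eq
    (Fintype.sum_unique _)

/-- `|√(ε² + |ψ|²) − ε|² ≤ |ψ|²` pointwise, in `ℝ≥0∞`. [folklore] -/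
theorem nnnorm_sqrtRegC_sq_le (ψ : Config N → ℂ) {ε : ℝ} (hε : 0 < ε) (X : Config N) :
    (‖((Real.sqrt (ε ^ 2 + ∑ _j : Unit, ‖ψ X‖ ^ 2) - ε : ℝ) : ℂ)‖₊ : ℝ≥0∞) ^ 2 ≤
      (‖ψ X‖₊ : ℝ≥0∞) ^ 2 :=
  (nnnorm_ofReal_sqrtReg_sq_le (fun _ : Unit => ψ) X hε).trans_eq (Fintype.sum_unique _)

/-- The regularised modulus vanishes where `ψ` does (`ε ≥ 0`). [folklore] -/
theorem sqrtRegC_eq_zero {ψ : Config N → ℂ} {X : Config N} (h : ψ X = 0) {ε : ℝ} (hε : 0 ≤ ε) :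
    ((Real.sqrt (ε ^ 2 + ∑ _j : Unit, ‖ψ X‖ ^ 2) - ε : ℝ) : ℂ) = 0 := by
  rw [h, norm_zero, zero_pow two_ne_zero, Finset.sum_const_zero, add_zero, Real.sqrt_sq hε,
    sub_self, Complex.ofReal_zero]

/-! ### Normalising a dominated admissible function -/

/-- **Normalisation of a dominated admissible function.** If `G` is `C¹`, Dirichlet, symmetric,
pointwise dominated by the trial state `Φ` (`|G|² ≤ |Φ|²`, `|∇G|² ≤ |∇Φ|²`) and `m = ∫|G|² ≠ 0`,
then `G/√m` is a trial state of energy `≤ m⁻¹ ⟨Φ, H_N Φ⟩` (for every `v ≥ 0`). [folklore] -/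
theorem exists_trialState_of_le (Φ : TrialState N L) {G : Config N → ℂ} (hG : ContDiff ℝ 1 G)
    (hG0 : ∀ X, X ∉ boxN N L → G X = 0)
    (hGσ : ∀ (σ : Equiv.Perm (Fin N)) (X : Config N), G (X ∘ σ) = G X)
    (hle : ∀ X, (‖G X‖₊ : ℝ≥0∞) ^ 2 ≤ (‖Φ.ψ X‖₊ : ℝ≥0∞) ^ 2)
    (hkin : ∀ X, kineticDensity G X ≤ kineticDensity Φ.ψ X)
    (hm : ∫⁻ X, (‖G X‖₊ : ℝ≥0∞) ^ 2 ≠ 0) :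
    ∃ Θ : TrialState N L,
      (Θ.ψ = fun X => ((Real.sqrt ((∫⁻ X, (‖G X‖₊ : ℝ≥0∞) ^ 2).toReal)⁻¹ : ℝ) : ℂ) * G X) ∧
        ∀ v : ℝ → ℝ≥0∞, energy v Θ ≤ (∫⁻ X, (‖G X‖₊ : ℝ≥0∞) ^ 2)⁻¹ * energy v Φ := by
  set m : ℝ≥0∞ := ∫⁻ X, (‖G X‖₊ : ℝ≥0∞) ^ 2 with hm_def
  have hmt : m ≠ ⊤ :=
    ne_top_of_le_ne_top ENNReal.one_ne_top ((lintegral_mono hle).trans_eq Φ.norm_eq)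
  set c : ℝ := Real.sqrt (m.toReal)⁻¹ with hc_def
  have hc2 : (‖(c : ℂ)‖₊ : ℝ≥0∞) ^ 2 = m⁻¹ := by
    rw [coe_nnnorm_ofReal_sq, hc_def, Real.sq_sqrt (inv_nonneg.2 ENNReal.toReal_nonneg),
      ENNReal.ofReal_inv_of_pos (ENNReal.toReal_pos hm hmt), ENNReal.ofReal_toReal hmt]
  have hsq : ∀ X, (‖(c : ℂ) * G X‖₊ : ℝ≥0∞) ^ 2 = m⁻¹ * (‖G X‖₊ : ℝ≥0∞) ^ 2 := fun X => by
    rw [nnnorm_mul, ENNReal.coe_mul, mul_pow, hc2]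
  have hdiff : Differentiable ℝ G := hG.differentiable one_ne_zero
  refine ⟨⟨fun X => (c : ℂ) * G X, contDiff_const.mul hG, fun X hX => by simp [hG0 X hX],
    fun σ X => by rw [hGσ σ X], ?_⟩, rfl, fun v => ?_⟩
  · simp_rw [hsq]
    rw [lintegral_const_mul' _ _ (ENNReal.inv_ne_top.2 hm), ENNReal.inv_mul_cancel hm hmt]
  · have hk : ∀ X, kineticDensity (fun X => (c : ℂ) * G X) X = m⁻¹ * kineticDensity G X := by
      intro X
      simp only [kineticDensity, Finset.mul_sum]
      refine Finset.sum_congr rfl fun i _ => Finset.sum_congr rfl fun k _ => ?_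
      rw [((hdiff X).hasFDerivAt.const_mul (c : ℂ)).fderiv]
      change (‖(c : ℂ) • fderiv ℝ G X _‖₊ : ℝ≥0∞) ^ 2 = _
      rw [nnnorm_smul, ENNReal.coe_mul, mul_pow, hc2]
    simp only [energy, hk, hsq]
    calc ∫⁻ X, m⁻¹ * kineticDensity G X + interaction v X * (m⁻¹ * (‖G X‖₊ : ℝ≥0∞) ^ 2)
        = m⁻¹ * ∫⁻ X, kineticDensity G X + interaction v X * (‖G X‖₊ : ℝ≥0∞) ^ 2 := by
          rw [← lintegral_const_mul' _ _ (ENNReal.inv_ne_top.2 hm)]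
          exact lintegral_congr fun X => by ring
      _ ≤ m⁻¹ * energy v Φ :=
          mul_le_mul_right (lintegral_mono fun X =>
            add_le_add (hkin X) (mul_le_mul_right (hle X) _)) _

/-! ### `L²` bookkeeping: masses and normalised sequences -/

/-- **Masses of an `L²`-convergent sequence**: if `∫ |Gₙ − F|² → 0` and `∫ |F|² = 1` then
`∫ |Gₙ|² → 1` (two triangle inequalities in `L²`: `1 − ‖Gₙ − F‖₂ ≤ ‖Gₙ‖₂ ≤ 1 + ‖Gₙ − F‖₂`).
[folklore] -/
theorem tendsto_lintegral_nnnorm_sq {G : ℕ → Config N → ℂ} {F : Config N → ℂ}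
    (hG : ∀ n, AEStronglyMeasurable (G n) volume) (hF : AEStronglyMeasurable F volume)
    (hF1 : ∫⁻ X, (‖F X‖₊ : ℝ≥0∞) ^ 2 = 1)
    (h : Tendsto (fun n => ∫⁻ X, (‖G n X - F X‖₊ : ℝ≥0∞) ^ 2) atTop (𝓝 0)) :
    Tendsto (fun n => ∫⁻ X, (‖G n X‖₊ : ℝ≥0∞) ^ 2) atTop (𝓝 1) := by
  have hF2 : eLpNorm F 2 volume = 1 := by rw [eLpNorm_two_eq_rpow, hF1, ENNReal.one_rpow]
  have hd : Tendsto (fun n => eLpNorm (G n - F) 2 volume) atTop (𝓝 0) := by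
    have h' : Tendsto (fun n => (∫⁻ X, (‖G n X - F X‖₊ : ℝ≥0∞) ^ 2) ^ (1 / 2 : ℝ)) atTop
        (𝓝 ((0 : ℝ≥0∞) ^ (1 / 2 : ℝ))) :=
      (ENNReal.continuous_rpow_const.tendsto 0).comp h
    rw [ENNReal.zero_rpow_of_pos (by norm_num)] at h'
    refine h'.congr fun n => ?_
    rw [eLpNorm_two_eq_rpow]
    rfl
  have hup : ∀ n, eLpNorm (G n) 2 volume ≤ 1 + eLpNorm (G n - F) 2 volume := fun n => by
    have e : F + (G n - F) = G n := add_sub_cancel F (G n)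
    have := eLpNorm_add_le hF ((hG n).sub hF) one_le_two (μ := volume)
    rwa [e, hF2] at this
  have hlow : ∀ n, 1 ≤ eLpNorm (G n) 2 volume + eLpNorm (G n - F) 2 volume := fun n => by
    have e : G n - (G n - F) = F := sub_sub_cancel _ _
    have := eLpNorm_sub_le (hG n) ((hG n).sub hF) one_le_two (μ := volume)
    rwa [e, hF2] at this
  have ha : Tendsto (fun n => eLpNorm (G n) 2 volume) atTop (𝓝 1) := by
    refine tendsto_of_tendsto_of_tendsto_of_le_of_le (g := fun n => 1 - eLpNorm (G n - F) 2 volume)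
      (h := fun n => 1 + eLpNorm (G n - F) 2 volume) ?_ ?_
      (fun n => tsub_le_iff_right.2 (hlow n)) hup
    · have h1 := ENNReal.Tendsto.sub tendsto_const_nhds hd (Or.inl ENNReal.one_ne_top)
      rwa [tsub_zero] at h1
    · have h1 : Tendsto (fun n => 1 + eLpNorm (G n - F) 2 volume) atTop (𝓝 (1 + 0)) :=
        tendsto_const_nhds.add hd
      rwa [add_zero] at h1
  have h2 := ((ENNReal.continuous_rpow_const (y := (2 : ℝ))).tendsto 1).comp ha
  rw [ENNReal.one_rpow] at h2
  refine h2.congr fun n => ?_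
  show eLpNorm (G n) 2 volume ^ (2 : ℝ) = _
  rw [eLpNorm_two_eq_rpow, ← ENNReal.rpow_mul, one_div, inv_mul_cancel₀ two_ne_zero,
    ENNReal.rpow_one]

/-- **Normalised sequences converge**: if `cₙ → 1`, `∫ |F|² = 1` and `∫ |Gₙ − F|² → 0`, then
`∫ |cₙ Gₙ − F|² → 0` (`cₙ Gₙ − F = cₙ (Gₙ − F) + (cₙ − 1) F`). [folklore] -/
theorem tendsto_lintegral_const_mul_sub {G : ℕ → Config N → ℂ} {F : Config N → ℂ}
    (hFm : Measurable F) (hF1 : ∫⁻ X, (‖F X‖₊ : ℝ≥0∞) ^ 2 = 1) {c : ℕ → ℝ}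
    (hc : Tendsto c atTop (𝓝 1))
    (hd : Tendsto (fun n => ∫⁻ X, (‖G n X - F X‖₊ : ℝ≥0∞) ^ 2) atTop (𝓝 0)) :
    Tendsto (fun n => ∫⁻ X, (‖(c n : ℂ) * G n X - F X‖₊ : ℝ≥0∞) ^ 2) atTop (𝓝 0) := by
  have hmeas : ∀ n, Measurable fun X =>
      2 * (ENNReal.ofReal ((c n - 1) ^ 2) * (‖F X‖₊ : ℝ≥0∞) ^ 2) := fun n =>
    ((hFm.nnnorm.coe_nnreal_ennreal.pow_const 2).const_mul _).const_mul _
  have hle : ∀ n, ∫⁻ X, (‖(c n : ℂ) * G n X - F X‖₊ : ℝ≥0∞) ^ 2 ≤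
      2 * (ENNReal.ofReal (c n ^ 2) * ∫⁻ X, (‖G n X - F X‖₊ : ℝ≥0∞) ^ 2) +
        2 * ENNReal.ofReal ((c n - 1) ^ 2) := by
    intro n
    calc ∫⁻ X, (‖(c n : ℂ) * G n X - F X‖₊ : ℝ≥0∞) ^ 2
        ≤ ∫⁻ X, 2 * (ENNReal.ofReal (c n ^ 2) * (‖G n X - F X‖₊ : ℝ≥0∞) ^ 2) +
            2 * (ENNReal.ofReal ((c n - 1) ^ 2) * (‖F X‖₊ : ℝ≥0∞) ^ 2) := by
          refine lintegral_mono fun X => ?_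
          have e : (c n : ℂ) * G n X - F X =
              (c n : ℂ) * (G n X - F X) + ((c n - 1 : ℝ) : ℂ) * F X := by
            push_cast
            ring
          rw [e]
          refine (coe_nnnorm_add_sq_le _ _).trans_eq ?_
          rw [nnnorm_mul, ENNReal.coe_mul, mul_pow, coe_nnnorm_ofReal_sq, nnnorm_mul,
            ENNReal.coe_mul, mul_pow, coe_nnnorm_ofReal_sq]
      _ = _ := by
          rw [lintegral_add_right _ (hmeas n), lintegral_const_mul' _ _ ENNReal.ofNat_ne_top,
            lintegral_const_mul' _ _ ENNReal.ofReal_ne_top,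
            lintegral_const_mul' _ _ ENNReal.ofNat_ne_top,
            lintegral_const_mul' _ _ ENNReal.ofReal_ne_top, hF1, mul_one]
  have hlim : Tendsto (fun n => 2 * (ENNReal.ofReal (c n ^ 2) *
      ∫⁻ X, (‖G n X - F X‖₊ : ℝ≥0∞) ^ 2) + 2 * ENNReal.ofReal ((c n - 1) ^ 2)) atTop (𝓝 0) := by
    have h1 : Tendsto (fun n => ENNReal.ofReal (c n ^ 2)) atTop (𝓝 1) := by
      have h := ENNReal.tendsto_ofReal (hc.pow 2)
      rwa [one_pow, ENNReal.ofReal_one] at h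
    have h2 : Tendsto (fun n => ENNReal.ofReal ((c n - 1) ^ 2)) atTop (𝓝 0) := by
      have h := ENNReal.tendsto_ofReal ((hc.sub_const 1).pow 2)
      rwa [sub_self, zero_pow two_ne_zero, ENNReal.ofReal_zero] at h
    have h3 := ENNReal.Tendsto.mul h1 (Or.inl one_ne_zero) hd (Or.inr ENNReal.one_ne_top)
    rw [mul_zero] at h3
    have h4 := (ENNReal.Tendsto.const_mul h3 (Or.inr ENNReal.ofNat_ne_top) (a := 2)).add
      (ENNReal.Tendsto.const_mul h2 (Or.inr ENNReal.ofNat_ne_top) (a := 2))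
    rwa [mul_zero, add_zero] at h4
  exact tendsto_of_tendsto_of_tendsto_of_le_of_le tendsto_const_nhds hlim (fun _ => zero_le) hle

/-! ### The diamagnetic approximation of `|Ψ|` -/

/-- **`|Ψ|` is approximated by trial states of asymptotically no larger energy.** If trial states
`Φₙ → Ψ` in `L²` (`Ψ` measurable) with `energy v Φₙ ≤ bₙ → E₀`, then there are trial states
`Θₙ → |Ψ|` in `L²` with `liminf energy v Θₙ ≤ E₀`: `Θₙ` is the normalised regularised modulus
`(√(εₙ² + |Φₙ|²) − εₙ)/‖·‖₂`, `εₙ = 1/(n+1)`, whose energy is `≤ ‖·‖₂⁻² energy v Φₙ` by the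
diamagnetic inequality, with `‖·‖₂ → 1`. [cite: ReedSimonIV1978, §XIII.12 Thm XIII.46] -/
theorem exists_tendstoL2_norm (v : ℝ → ℝ≥0∞) {Φ : ℕ → TrialState N L} {Ψ : Config N → ℂ}
    (hΨm : Measurable Ψ) (hL2 : TendstoL2 Φ Ψ) {E₀ : ℝ≥0∞} {b : ℕ → ℝ≥0∞}
    (hb : Tendsto b atTop (𝓝 E₀)) (hΦb : ∀ n, energy v (Φ n) ≤ b n) :
    ∃ Θ : ℕ → TrialState N L, TendstoL2 Θ (fun X => ((‖Ψ X‖ : ℝ) : ℂ)) ∧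
      liminf (fun n => energy v (Θ n)) atTop ≤ E₀ := by
  have hε : ∀ n : ℕ, (0 : ℝ) < 1 / ((n : ℝ) + 1) := fun n => Nat.one_div_pos_of_nat
  -- the regularised moduli
  obtain ⟨G, hG⟩ : ∃ G : ℕ → Config N → ℂ, G = fun (n : ℕ) (X : Config N) =>
      ((Real.sqrt ((1 / ((n : ℝ) + 1)) ^ 2 + ∑ _j : Unit, ‖(Φ n).ψ X‖ ^ 2) -
        1 / ((n : ℝ) + 1) : ℝ) : ℂ) := ⟨_, rfl⟩
  have hGc : ∀ n, ContDiff ℝ 1 (G n) := fun n => by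
    rw [hG]; exact contDiff_sqrtRegC (Φ n).contDiff (hε n)
  -- the limit `|Ψ|` is normalised
  have hFm : Measurable fun X => ((‖Ψ X‖ : ℝ) : ℂ) := Complex.measurable_ofReal.comp hΨm.norm
  have hF1 : ∫⁻ X, (‖((‖Ψ X‖ : ℝ) : ℂ)‖₊ : ℝ≥0∞) ^ 2 = 1 := by
    rw [← hL2.lintegral_nnnorm_sq_eq_one hΨm.aestronglyMeasurable]
    refine lintegral_congr fun X => ?_
    rw [Complex.nnnorm_real, nnnorm_norm]
  -- `Gₙ → |Ψ|` in `L²`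
  have hd : Tendsto (fun n => ∫⁻ X, (‖G n X - ((‖Ψ X‖ : ℝ) : ℂ)‖₊ : ℝ≥0∞) ^ 2) atTop (𝓝 0) := by
    have hle : ∀ n : ℕ, ∫⁻ X, (‖G n X - ((‖Ψ X‖ : ℝ) : ℂ)‖₊ : ℝ≥0∞) ^ 2 ≤
        2 * (ENNReal.ofReal ((1 / ((n : ℝ) + 1)) ^ 2) * volume (boxN N L)) +
          2 * ∫⁻ X, (‖(Φ n).ψ X - Ψ X‖₊ : ℝ≥0∞) ^ 2 := by
      intro n
      calc ∫⁻ X, (‖G n X - ((‖Ψ X‖ : ℝ) : ℂ)‖₊ : ℝ≥0∞) ^ 2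
          ≤ ∫⁻ X, 2 * (boxN N L).indicator
              (fun _ => ENNReal.ofReal ((1 / ((n : ℝ) + 1)) ^ 2)) X +
              2 * (‖(Φ n).ψ X - Ψ X‖₊ : ℝ≥0∞) ^ 2 := by
            refine lintegral_mono fun X => ?_
            rw [hG]
            exact nnnorm_sqrtReg_sub_norm_sq_le (Φ n) Ψ (hε n) X
        _ = _ := by
            rw [lintegral_add_left
                ((measurable_const.indicator (measurableSet_boxN N L)).const_mul _),
              lintegral_const_mul' _ _ ENNReal.ofNat_ne_top,
              lintegral_const_mul' _ _ ENNReal.ofNat_ne_top,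
              lintegral_indicator_const (measurableSet_boxN N L)]
    have hlim : Tendsto (fun n : ℕ =>
        2 * (ENNReal.ofReal ((1 / ((n : ℝ) + 1)) ^ 2) * volume (boxN N L)) +
          2 * ∫⁻ X, (‖(Φ n).ψ X - Ψ X‖₊ : ℝ≥0∞) ^ 2) atTop (𝓝 0) := by
      have h1 : Tendsto (fun n : ℕ => ENNReal.ofReal ((1 / ((n : ℝ) + 1)) ^ 2)) atTop (𝓝 0) := by
        have h := ENNReal.tendsto_ofReal (tendsto_one_div_add_atTop_nhds_zero_nat.pow 2)
        rwa [zero_pow two_ne_zero, ENNReal.ofReal_zero] at h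
      have h2 := ENNReal.Tendsto.mul_const h1 (Or.inr (volume_boxN_lt_top N L).ne)
      rw [zero_mul] at h2
      have h3 := (ENNReal.Tendsto.const_mul h2 (Or.inr ENNReal.ofNat_ne_top) (a := 2)).add
        (ENNReal.Tendsto.const_mul hL2 (Or.inr ENNReal.ofNat_ne_top) (a := 2))
      rwa [mul_zero, add_zero] at h3
    exact tendsto_of_tendsto_of_tendsto_of_le_of_le tendsto_const_nhds hlim (fun _ => zero_le) hle
  -- masses `→ 1`
  have hm : Tendsto (fun n => ∫⁻ X, (‖G n X‖₊ : ℝ≥0∞) ^ 2) atTop (𝓝 1) :=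
    tendsto_lintegral_nnnorm_sq (fun n => (hGc n).continuous.aestronglyMeasurable)
      hFm.aestronglyMeasurable hF1 hd
  -- the normalised trial states (junk where the mass vanishes, which happens only finitely often)
  have hex : ∀ n, ∃ Θ : TrialState N L, ∫⁻ X, (‖G n X‖₊ : ℝ≥0∞) ^ 2 ≠ 0 →
      (Θ.ψ = fun X => ((Real.sqrt ((∫⁻ X, (‖G n X‖₊ : ℝ≥0∞) ^ 2).toReal)⁻¹ : ℝ) : ℂ) * G n X) ∧
        energy v Θ ≤ (∫⁻ X, (‖G n X‖₊ : ℝ≥0∞) ^ 2)⁻¹ * energy v (Φ n) := by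
    intro n
    by_cases h0 : ∫⁻ X, (‖G n X‖₊ : ℝ≥0∞) ^ 2 = 0
    · exact ⟨Φ n, fun h => absurd h0 h⟩
    obtain ⟨Θ, h1, h2⟩ := exists_trialState_of_le (Φ n) (hGc n)
      (fun X hX => by rw [hG]; exact sqrtRegC_eq_zero ((Φ n).eq_zero X hX) (hε n).le)
      (fun σ X => by rw [hG]; simp only [(Φ n).symm σ X])
      (fun X => by rw [hG]; exact nnnorm_sqrtRegC_sq_le _ (hε n) X)
      (fun X => by rw [hG]; exact kineticDensity_sqrtRegC_le (Φ n).contDiff (hε n) X) h0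
    exact ⟨Θ, fun _ => ⟨h1, h2 v⟩⟩
  choose Θ hΘ using hex
  have hev : ∀ᶠ n in atTop, ∫⁻ X, (‖G n X‖₊ : ℝ≥0∞) ^ 2 ≠ 0 := hm.eventually_ne one_ne_zero
  refine ⟨Θ, ?_, ?_⟩
  · -- the normalising constants `→ 1`, so `Θₙ → |Ψ|`
    have hc : Tendsto (fun n => Real.sqrt ((∫⁻ X, (‖G n X‖₊ : ℝ≥0∞) ^ 2).toReal)⁻¹) atTop
        (𝓝 1) := by
      have h1 := (ENNReal.tendsto_toReal ENNReal.one_ne_top).comp hm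
      rw [ENNReal.toReal_one] at h1
      have h2 := (Real.continuous_sqrt.tendsto _).comp (h1.inv₀ one_ne_zero)
      rwa [inv_one, Real.sqrt_one] at h2
    refine (tendsto_lintegral_const_mul_sub (G := G) hFm hF1 hc hd).congr'
      (hev.mono fun n hn => ?_)
    beta_reduce
    rw [(hΘ n hn).1]
  · have hup : Tendsto (fun n => (∫⁻ X, (‖G n X‖₊ : ℝ≥0∞) ^ 2)⁻¹ * b n) atTop (𝓝 E₀) := by
      have h := hm.inv
      rw [inv_one] at h
      have h' := ENNReal.Tendsto.mul h (Or.inl one_ne_zero) hb (Or.inr ENNReal.one_ne_top)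
      rwa [one_mul] at h'
    refine (liminf_le_liminf (hev.mono fun n hn => ?_)).trans hup.liminf_eq.le
    exact (hΘ n hn).2.trans (mul_le_mul_right (hΦb n) _)

end ExistsNonneg

/-! ### The stub -/

open ExistsNonneg in
/-- **Stub `stub_existsNonnegGroundState` of line `Sketch` — a nonnegative ground state exists,
given compactness.** If bounded-energy sequences of trial states are `L²`-precompact with
measurable, Dirichlet, Bose-symmetric limits (the registered statement of `stub_compactness`),
then for every pair potential `v` and every `(N, L)` with `groundStateEnergy v N L < ⊤` there is
`Ψ₀ : (ℝ³)^N → ℝ`, `Ψ₀ ≥ 0`, with `IsGroundState v L Ψ₀`: a minimising sequence has a subsequence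
`Φₙ → Ψ` in `L²`, and the normalised regularised moduli `√(εₙ² + |Φₙ|²) − εₙ` are trial states
converging to `|Ψ|` with energies `≤ (1 + o(1)) (E₀ + o(1))` (diamagnetic inequality), so
`Ψ₀ = |Ψ|` is a ground state (`IsGroundState.of_tendstoL2`).
[cite: ReedSimonIV1978, §XIII.12 Thm XIII.46] -/
theorem stub_existsNonnegGroundState :
    (∀ (N : ℕ) (L : ℝ) (v : ℝ → ℝ≥0∞) (E : ℝ≥0∞) (Φ : ℕ → TrialState N L), E ≠ ⊤ →
      (∀ n, energy v (Φ n) ≤ E) →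
      ∃ (Ψ : Config N → ℂ) (φ : ℕ → ℕ), StrictMono φ ∧ Measurable Ψ ∧
        (∀ X, X ∉ boxN N L → Ψ X = 0) ∧
        (∀ (σ : Equiv.Perm (Fin N)) (X : Config N), Ψ (X ∘ σ) = Ψ X) ∧
        TendstoL2 (fun n => Φ (φ n)) Ψ) →
    ∀ (N : ℕ) (v : ℝ → ℝ≥0∞) (L : ℝ), groundStateEnergy v N L ≠ ⊤ →
      ∃ Ψ₀ : Config N → ℝ, (∀ X, 0 ≤ Ψ₀ X) ∧ IsGroundState v L (fun X => (Ψ₀ X : ℂ)) := by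
  intro hC N v L hE
  -- a minimising sequence and a convergent subsequence
  have hex : ∀ n : ℕ, ∃ Φ : TrialState N L,
      energy v Φ < groundStateEnergy v N L + ((n + 1 : ℕ) : ℝ≥0∞)⁻¹ := fun n =>
    iInf_lt_iff.1 (ENNReal.lt_add_right hE (ENNReal.inv_pos.2 (ENNReal.natCast_ne_top _)).ne')
  choose Φ hΦ using hex
  have hEtop : groundStateEnergy v N L + 1 ≠ ⊤ := ENNReal.add_ne_top.2 ⟨hE, ENNReal.one_ne_top⟩
  obtain ⟨Ψ, φ, hφ, hm, h0, hσ, hL2⟩ := hC N L v _ Φ hEtop fun n => (hΦ n).le.trans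
    (add_le_add le_rfl (ENNReal.inv_le_one.2 (by exact_mod_cast Nat.le_add_left 1 n)))
  have hup : Tendsto (fun n => groundStateEnergy v N L + ((φ n + 1 : ℕ) : ℝ≥0∞)⁻¹) atTop
      (𝓝 (groundStateEnergy v N L)) := by
    have h := ((ENNReal.tendsto_inv_nat_nhds_zero.comp (tendsto_add_atTop_nat 1)).comp
      hφ.tendsto_atTop).const_add (groundStateEnergy v N L)
    rwa [add_zero] at h
  -- the diamagnetic approximation of `|Ψ|`
  obtain ⟨Θ, hΘ, hlim⟩ := exists_tendstoL2_norm v hm hL2 hup fun n => (hΦ (φ n)).le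
  exact ⟨fun X => ‖Ψ X‖, fun X => norm_nonneg _,
    IsGroundState.of_tendstoL2 (Complex.measurable_ofReal.comp hm.norm)
      (fun X hX => by simp [h0 X hX]) (fun σ X => by simp only [hσ σ X]) hE hΘ hlim⟩

end Summit.AtomisticToContinuum.BoseEinsteinCondensation.Theorems.GroundStateRigidity

end
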